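import Literature.NumberTheory.Automorphic.EllipticCurveCyclicBaseChangeNonTwistProofs
import Literature.NumberTheory.Automorphic.EllipticCurveRatCuspidalRepProofs
import Literature.NumberTheory.Automorphic.SolvableBaseChangeModularity
import Literature.NumberTheory.Automorphic.BaseChangeCyclicCuspidal
import Literature.NumberTheory.Automorphic.BaseChangeArchimedeanProofs
import Literature.NumberTheory.Automorphic.ReciprocityGLnPotentialModularityTateProofs
import Literature.NumberTheory.Automorphic.GLnAdelicStructureProofs
import Literature.NumberTheory.Automorphic.AdeleBaseChange
import Literature.NumberTheory.Automorphic.ReciprocityGLnRestrictionProofs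
import Literature.AlgebraicGeometry.Resolution.AbelianPrimeGaloisTower
import HarnessLib

/-!
# Modularity of `E₀ ⊗ K` for `K` totally real, solvable over `ℚ`: the base-change tower (proofs)

Topic `Literature/NumberTheory/Automorphic`; a *proofs* file (theorems only: no definition, no
named fact, no instance): the assembly of the discharge programme of the named fact
`Literature.NumberTheory.Automorphic.isModularEllipticCurve_baseChange_rat_of_isSolvable`
(`SolvableBaseChangeModularity`; Thorne, *Automorphy of some residually dihedral Galois
representations* (2016), Lemma 7.1 with `F = ℚ`: "`π_K = BC_{K/ℚ}(π(E₀))` exists as `K/ℚ` is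
solvable", printed as BCDT Thm. A + Langlands–Arthur–Clozel cyclic base change).  It proves that
fact for every `K` with `[K : ℚ] > 1`, and for `K = ℚ` itself, from the three printed inputs as
they stand in the tree:

* the Modularity Theorem over `ℚ` (`EllipticCurves.ModularForms.exists_isNewformOf`, BCDT Thm. A),
  through `exists_hasWeightZero_satake_of_exists_isNewformOf` (`EllipticCurveRatCuspidalRepProofs`):
  a weight-zero cuspidal `π(E₀)` on `GL₂(𝔸_ℚ)` with `∏ (X - √p αᵢ) = X² - a_p(E₀) X + p` a.e.;
* Arthur–Clozel's cyclic base change of prime degree with its cuspidality criterion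
  (`baseChange_cyclic_cuspidal`, Thm. III.4.2 (a)), whose non-twist hypothesis for the
  representations met along the tower is PROVED in `EllipticCurveCyclicBaseChangeNonTwistProofs`
  (`exists_inert_hasSatakeParamAt_map_ne_of_prime`: complex conjugation, Burnside, density of
  Frobenii; no open-image input, CM curves included);
* its archimedean component (`ArthurClozel1989_strongLifting_archimedean`, Thm. III.5.1), through
  `hasWeightZero_baseChange` (`BaseChangeArchimedeanProofs`).

Contents:

* `eventually_hasSatakeParamAt_frobenius_of_isWeakBaseChangeLiftAE` — the compatibility
  "`∏ (X - √q_v αᵢ) = X² - a_v(E₀ ⊗ F) X + q_v` a.e." is transported along a weak base change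
  lift (`t_{Π,w} = t_{π,v}^{f(w|v)}`; `a_w(E₀ ⊗ E) = λ^f + μ^f`,
  `frobeniusTraceAt_baseChange_eq_eval_dickson`);
* `exists_cuspidal_hasWeightZero_frobenius_step` — one Galois step of prime degree;
* `exists_normal_index_prime_of_isSolvable` — a finite solvable group `≠ 1` has a normal
  subgroup of prime index;
* `exists_cuspidal_hasWeightZero_frobenius_of_isSolvable` — the tower: induction on `[K : F]`
  through the fixed field of a normal subgroup of prime index;
* `isModularEllipticCurve_of_eventually_hasSatakeParamAt` — from the compatibility to
  `IsModularEllipticCurve` (`√q_w Σα = a_w = frobTraceAt`, `frobeniusTraceAt_baseChange_eq_frobTraceAt`);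
* `isModularEllipticCurve_baseChange_of_one_lt_finrank`,
  `isModularEllipticCurve_baseChange_rat_of_isSolvable_of_one_lt_finrank` — **the fact for
  `[K : ℚ] > 1`**; `isModularEllipticCurve_rat_of_exists_isNewformOf` — **the fact for `K = ℚ`**.

What is NOT reached: a field `K` of degree `1` over `ℚ` other than `ℚ` itself (`K ≃ ℚ` as a
type different from `ℚ`): base change needs prime degree, and the tree has no transport of
`CuspidalAutomorphicRepData` along a field isomorphism `ℚ ≃ K`.

## References

* J. A. Thorne, *Automorphy of some residually dihedral Galois representations*, Math. Ann. 364
  (2016), Lemma 7.1. [Thorne2016]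
* J. Arthur, L. Clozel, *Simple algebras, base change, and the advanced theory of the trace
  formula*, Ann. of Math. Stud. 120 (1989), Ch. 3, §1 Def. 1.1, Thm. 4.2, Thm. 5.1.
  [ArthurClozelAMS120]
* R. P. Langlands, *Base change for GL(2)*, Ann. of Math. Stud. 96 (1980), Ch. 2, pp. 10–13.
  [Langlands1980AMS96]
* C. Breuil, B. Conrad, F. Diamond, R. Taylor, J. Amer. Math. Soc. 14 (2001), Thm. A.
  [BCDTJAMS2001]
* A. Caraiani, J. Newton, *On the modularity of elliptic curves over imaginary quadratic
  fields* (2023), p. 2. [CaraianiNewton2023]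
* J. H. Silverman, *The arithmetic of elliptic curves*, 2nd ed. (2009), Thm. V.2.3.1, C.§16.
  [SilvermanAEC2009]

## Design notes

No definition: the compatibility clause is written out at each occurrence (it is the `π`-clause
of `IsModularEllipticCurve` before the identification `√q_w Σα = a_w`).  The group-theoretic
input is `Literature.AlgebraicGeometry.Resolution.exists_normal_prime_relIndex_of_commutator_mem`
with Mathlib's `IsSolvable.commutator_lt_top_of_nontrivial`; the Galois bookkeeping is Mathlib's
fundamental theorem (`fixedField`, `finrank_fixedField_eq_card`, `of_fixedField_normal_subgroup`,
`fixingSubgroupEquiv`).  No `sorry`, no new instance; axioms `propext`, `Classical.choice`,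
`Quot.sound`.
-/

noncomputable section

open scoped MatrixGroups Matrix NumberField Polynomial
open NumberField IsDedekindDomain Field Polynomial Filter
open Literature.NumberTheory.GaloisRepresentations Literature.NumberTheory.EllipticCurves

namespace Literature.NumberTheory.Automorphic

/-! ### Transport of the Satake–Frobenius compatibility along a weak base change lift -/

section Transport

open WeierstrassCurve

variable {F : Type} [Field F] [NumberField F] {E : Type} [Field E] [NumberField E] [Algebra F E]

/-- `(E₀ ⊗ F) ⊗ E = E₀ ⊗ E` for a curve over `ℚ` (ring homomorphisms out of `ℚ` are unique).
[folklore] -/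
theorem baseChange_baseChange_rat (W : WeierstrassCurve ℚ) :
    (W.baseChange F).baseChange E = W.baseChange E := by
  rw [WeierstrassCurve.baseChange, WeierstrassCurve.baseChange, WeierstrassCurve.baseChange,
    WeierstrassCurve.map_map]
  exact congrArg W.map (Subsingleton.elim _ _)

open scoped Classical in
/-- **The compatibility "`∏ (X - √q_v αᵢ) = X² - a_v(E₀ ⊗ F) X + q_v` at almost every `v`" is
transported along a weak base change lift** `π ↦ Π` (`IsWeakBaseChangeLiftAE`: `t_{Π,w} =
t_{π,v}^{f(w|v)}` at almost every `w ∣ v`): if `{√q_v α₁, √q_v α₂} = {λ, μ}` are the Frobenius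
eigenvalues of `E₀ ⊗ F` at `v` then `{√q_w α₁^f, √q_w α₂^f} = {λ^f, μ^f}` (`q_w = q_v^f`) are
those of `E₀ ⊗ E` at `w`: `λ^f + μ^f = a_w(E₀ ⊗ E)` (`frobeniusTraceAt_baseChange_eq_eval_dickson`,
`pow_add_pow_eq_eval_dickson`) and `(λμ)^f = q_w`.  The exceptional places of `E` are those above
the finitely many exceptional places of `F` (`HeightOneSpectrum.tendsto_under_cofinite`).
[cite: ArthurClozelAMS120, Ch. 3, §1 (1.1) and Def. 1.1] [cite: SilvermanAEC2009, Thm. V.2.3.1] -/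
theorem eventually_hasSatakeParamAt_frobenius_of_isWeakBaseChangeLiftAE (W : WeierstrassCurve ℚ)
    [W.IsElliptic] {hF : isCompact_glFiniteIntegralLevel 2 F} {hE : isCompact_glFiniteIntegralLevel 2 E}
    {π : AutomorphicRepData (AutomorphyDatum.gl 2 F hF)}
    {P : AutomorphicRepData (AutomorphyDatum.gl 2 E hE)} (hlift : IsWeakBaseChangeLiftAE π P)
    (hπ : ∀ᶠ v : HeightOneSpectrum (𝓞 F) in cofinite, ∃ α : Multiset ℂ,
      π.HasSatakeParamAt v α ∧
        (α.map fun z => X - C ((((Real.sqrt (v.residueCard : ℝ)) : ℝ) : ℂ) * z)).prod =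
          X ^ 2 - C (((W.baseChange F).frobeniusTraceAt v : ℤ) : ℂ) * X +
            C ((v.residueCard : ℕ) : ℂ)) :
    ∀ᶠ w : HeightOneSpectrum (𝓞 E) in cofinite, ∃ β : Multiset ℂ,
      P.HasSatakeParamAt w β ∧
        (β.map fun z => X - C ((((Real.sqrt (w.residueCard : ℝ)) : ℝ) : ℂ) * z)).prod =
          X ^ 2 - C (((W.baseChange E).frobeniusTraceAt w : ℤ) : ℂ) * X +
            C ((w.residueCard : ℕ) : ℂ) := by
  classical
  haveI hWF : (W.baseChange F).IsElliptic := by rw [WeierstrassCurve.baseChange]; infer_instance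
  have h1 := (HeightOneSpectrum.tendsto_under_cofinite (𝓞 F) (B := 𝓞 E)).eventually
    (hπ.and (W.baseChange F).eventually_hasGoodReductionAt)
  filter_upwards [hlift, h1] with w hw hv
  obtain ⟨⟨α, hα, hprod⟩, hgood⟩ := hv
  set v : HeightOneSpectrum (𝓞 F) := w.under (𝓞 F) with hvdef
  have hvw : w.asIdeal.under (𝓞 F) = v.asIdeal := rfl
  set f : ℕ := w.asIdeal.inertiaDeg (𝓞 F) with hf
  refine ⟨α.map (· ^ f), hw v α hvw hα, ?_⟩
  obtain ⟨x, y, rfl⟩ := Multiset.card_eq_two.mp hα.card_eq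
  set c : ℂ := (((Real.sqrt (v.residueCard : ℝ)) : ℝ) : ℂ) with hc
  have hqw : w.residueCard = v.residueCard ^ f := residueCard_eq_residueCard_pow_inertiaDeg hvw
  have hcw : (((Real.sqrt (w.residueCard : ℝ)) : ℝ) : ℂ) = c ^ f := by
    rw [hqw, Nat.cast_pow, real_sqrt_pow (Nat.cast_nonneg _) f, Complex.ofReal_pow]
  have emul : ∀ s t : ℂ, (X - C s) * (X - C t) = X ^ 2 - C (s + t) * X + C (s * t) := by
    intro s t; rw [map_add, map_mul]; ring
  simp only [Multiset.insert_eq_cons, Multiset.map_cons, Multiset.map_singleton,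
    Multiset.prod_cons, Multiset.prod_singleton] at hprod ⊢
  rw [emul] at hprod ⊢
  have e1 := congrArg (fun P : ℂ[X] ↦ P.coeff 1) hprod
  have e0 := congrArg (fun P : ℂ[X] ↦ P.coeff 0) hprod
  simp only [coeff_add, coeff_sub, coeff_C_mul, coeff_X_pow, coeff_X_one, coeff_C,
    if_neg (one_ne_zero), if_neg (show (1 : ℕ) ≠ 2 by decide)] at e1
  simp only [coeff_add, coeff_sub, coeff_C_mul, coeff_X_pow, coeff_X_zero, coeff_C_zero,
    if_neg (show (0 : ℕ) ≠ 2 by decide)] at e0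
  have hsum : c * x + c * y = (((W.baseChange F).frobeniusTraceAt v : ℤ) : ℂ) := by
    linear_combination -e1
  have hprd : c * x * (c * y) = ((v.residueCard : ℕ) : ℂ) := by linear_combination e0
  -- `a_w(E₀ ⊗ E) = (c x)^f + (c y)^f`
  have haw : (((W.baseChange E).frobeniusTraceAt w : ℤ) : ℂ) = (c * x) ^ f + (c * y) ^ f := by
    have h := (W.baseChange F).frobeniusTraceAt_baseChange_eq_eval_dickson E hvw hgood
    rw [baseChange_baseChange_rat] at h
    rw [h, pow_add_pow_eq_eval_dickson hsum hprd f]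
    have h5 := Polynomial.eval₂_hom (Int.castRingHom ℂ) ((W.baseChange F).frobeniusTraceAt v)
      (p := Polynomial.dickson 1 (v.residueCard : ℤ) f)
    rw [← Polynomial.eval_map, Polynomial.map_dickson, eq_intCast, eq_intCast, eq_intCast,
      Int.cast_natCast] at h5
    exact h5.symm
  rw [hcw, haw, hqw, Nat.cast_pow, ← hprd]
  congr 1
  · congr 2
    ring
  · congr 1
    ring

end Transport

/-! ### One step of prime degree, and the tower -/

section Tower

open WeierstrassCurve

/-- A real embedding of a totally real number field. [folklore] -/
theorem exists_ringHom_real (K : Type) [Field K] [NumberField K] [IsTotallyReal K] :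
    Nonempty (K →+* ℝ) :=
  ⟨(IsTotallyReal.complexEmbedding_isReal
    (Classical.arbitrary (NumberField.InfinitePlace K)).embedding).embedding⟩

open scoped Classical in
/-- **One cyclic step of prime degree** (Thorne 2016, proof of Lemma 7.1; Arthur–Clozel Thm.
III.4.2 (a) and Thm. III.5.1): if `π` is a cuspidal automorphic representation of `GL₂(𝔸_F)`
of weight zero, compatible with `E₀ ⊗ F` at almost every place, and `E / F` is Galois of prime
degree with `E` admitting a real place, then some cuspidal `Π` on `GL₂(𝔸_E)` of weight zero is
compatible with `E₀ ⊗ E` at almost every place: the non-twist hypothesis holds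
(`exists_inert_hasSatakeParamAt_map_ne_of_prime`), cyclic base change gives a cuspidal weak lift
(`baseChange_cyclic_cuspidal`), weight zero ascends (`hasWeightZero_baseChange`, from
`ArthurClozel1989_strongLifting_archimedean`) and the compatibility is transported
(`eventually_hasSatakeParamAt_frobenius_of_isWeakBaseChangeLiftAE`).
[cite: Thorne2016, Lemma 7.1] [cite: ArthurClozelAMS120, Ch. 3 Thm. 4.2 (a) and Thm. 5.1] -/
theorem exists_cuspidal_hasWeightZero_frobenius_step (hBC : baseChange_cyclic_cuspidal)
    (hArch : ArthurClozel1989_strongLifting_archimedean) (W : WeierstrassCurve ℚ) [W.IsElliptic]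
    {F E : Type} [Field F] [NumberField F] [Field E] [NumberField E] [Algebra F E] [IsGalois F E]
    (hp : (Module.finrank F E).Prime) (φ : E →+* ℝ) {hF : isCompact_glFiniteIntegralLevel 2 F}
    (π : CuspidalAutomorphicRepData 2 F hF) (hwt : π.1.HasWeightZero)
    (hπ : ∀ᶠ v : HeightOneSpectrum (𝓞 F) in cofinite, ∃ α : Multiset ℂ,
      π.1.HasSatakeParamAt v α ∧
        (α.map fun z => X - C ((((Real.sqrt (v.residueCard : ℝ)) : ℝ) : ℂ) * z)).prod =
          X ^ 2 - C (((W.baseChange F).frobeniusTraceAt v : ℤ) : ℂ) * X +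
            C ((v.residueCard : ℕ) : ℂ))
    (hE : isCompact_glFiniteIntegralLevel 2 E) :
    ∃ P : CuspidalAutomorphicRepData 2 E hE, P.1.HasWeightZero ∧
      ∀ᶠ w : HeightOneSpectrum (𝓞 E) in cofinite, ∃ β : Multiset ℂ,
        P.1.HasSatakeParamAt w β ∧
          (β.map fun z => X - C ((((Real.sqrt (w.residueCard : ℝ)) : ℝ) : ℂ) * z)).prod =
            X ^ 2 - C (((W.baseChange E).frobeniusTraceAt w : ℤ) : ℂ) * X +
              C ((w.residueCard : ℕ) : ℂ) := by
  classical
  haveI : FiniteDimensional F E := Module.finite_of_finrank_pos hp.pos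
  have hcyc : IsCyclic (E ≃ₐ[F] E) := by
    haveI : Fact (Module.finrank F E).Prime := ⟨hp⟩
    exact isCyclic_of_prime_card (IsGalois.card_aut_eq_finrank F E)
  obtain ⟨P, hlift⟩ := hBC 2 F E hp hF π
    (exists_inert_hasSatakeParamAt_map_ne_of_prime W E φ hp π.1 hπ) hE
  exact ⟨P, hArch.hasWeightZero_baseChange hcyc hp hlift hwt,
    eventually_hasSatakeParamAt_frobenius_of_isWeakBaseChangeLiftAE W hlift hπ⟩

/-- **A finite solvable group `G ≠ 1` has a normal subgroup of prime index** (the last proper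
term of a composition series refined from the derived series: `[G, G] < G` for `G` solvable,
`IsSolvable.commutator_lt_top_of_nontrivial`, and a maximal subgroup containing `[G, G]` is
normal of prime index, `exists_normal_prime_relIndex_of_commutator_mem`). [folklore] -/
theorem exists_normal_index_prime_of_isSolvable (G : Type*) [Group G] [Finite G] [IsSolvable G]
    [Nontrivial G] : ∃ N : Subgroup G, N.Normal ∧ N.index.Prime := by
  obtain ⟨H', -, hlt, hnorm, hprime⟩ :=
    Literature.AlgebraicGeometry.Resolution.exists_normal_prime_relIndex_of_commutator_mem
      (G := G) (K := commutator G) (H := ⊤) (IsSolvable.commutator_lt_top_of_nontrivial G)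
      (fun s _ t _ => by
        rw [← commutatorElement_def]
        exact Subgroup.commutator_mem_commutator (Subgroup.mem_top s) (Subgroup.mem_top t))
  refine ⟨H', ⟨fun h hh s => hnorm s (Subgroup.mem_top s) h hh⟩, ?_⟩
  rwa [Subgroup.relIndex_top_right] at hprime

open scoped Classical in
/-- **Cyclic base change up a solvable totally real tower** (Thorne 2016, proof of Lemma 7.1:
"as `K/ℚ` is solvable, `π_K = BC_{K/ℚ}(π)` exists, by iterating cyclic base change of prime
degree along a subnormal series"; Langlands 1980, Ch. 2): for `K / F` Galois with solvable group,
`1 < [K : F]`, `K` totally real, a weight-zero cuspidal `π` on `GL₂(𝔸_F)` compatible with `E₀ ⊗ F`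
gives a weight-zero cuspidal `Π` on `GL₂(𝔸_K)` compatible with `E₀ ⊗ K`.  Induction on `[K : F]`:
a normal subgroup `N ◁ Gal(K/F)` of prime index (`exists_normal_index_prime_of_isSolvable`) has
fixed field `F₁`, Galois of prime degree over `F`; one step (`exists_cuspidal_hasWeightZero_frobenius_step`)
reaches `F₁` (or `K` itself when `[K : F]` is prime), and `K / F₁` is Galois with group `N`,
solvable of smaller order. [cite: Thorne2016, Lemma 7.1]
[cite: Langlands1980AMS96, Ch. 2, pp. 10–13] -/
theorem exists_cuspidal_hasWeightZero_frobenius_of_isSolvable (hBC : baseChange_cyclic_cuspidal)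
    (hArch : ArthurClozel1989_strongLifting_archimedean) (W : WeierstrassCurve ℚ) [W.IsElliptic]
    (K : Type) [Field K] [NumberField K] [IsTotallyReal K] (n : ℕ) :
    ∀ (F : Type) [Field F] [NumberField F] [Algebra F K] [IsGalois F K]
      [IsSolvable (K ≃ₐ[F] K)], Module.finrank F K = n → 1 < n →
      ∀ {hF : isCompact_glFiniteIntegralLevel 2 F} (π : CuspidalAutomorphicRepData 2 F hF),
        π.1.HasWeightZero →
        (∀ᶠ v : HeightOneSpectrum (𝓞 F) in cofinite, ∃ α : Multiset ℂ,
          π.1.HasSatakeParamAt v α ∧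
            (α.map fun z => X - C ((((Real.sqrt (v.residueCard : ℝ)) : ℝ) : ℂ) * z)).prod =
              X ^ 2 - C (((W.baseChange F).frobeniusTraceAt v : ℤ) : ℂ) * X +
                C ((v.residueCard : ℕ) : ℂ)) →
        ∀ (hK : isCompact_glFiniteIntegralLevel 2 K),
          ∃ P : CuspidalAutomorphicRepData 2 K hK, P.1.HasWeightZero ∧
            ∀ᶠ w : HeightOneSpectrum (𝓞 K) in cofinite, ∃ β : Multiset ℂ,
              P.1.HasSatakeParamAt w β ∧
                (β.map fun z => X - C ((((Real.sqrt (w.residueCard : ℝ)) : ℝ) : ℂ) * z)).prod =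
                  X ^ 2 - C (((W.baseChange K).frobeniusTraceAt w : ℤ) : ℂ) * X +
                    C ((w.residueCard : ℕ) : ℂ) := by
  obtain ⟨φK⟩ := exists_ringHom_real K
  induction n using Nat.strong_induction_on with
  | _ n ih =>
  intro F _ _ _ _ _ hn h1 hF π hwt hπ hK
  haveI : FiniteDimensional F K := Module.finite_of_finrank_pos (by omega)
  by_cases hprime : n.Prime
  · -- the last step lands on `K` itself
    exact exists_cuspidal_hasWeightZero_frobenius_step hBC hArch W (hn ▸ hprime) φK π hwt hπ hK
  · -- a normal subgroup of prime index and its fixed field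
    haveI : Finite (K ≃ₐ[F] K) := inferInstance
    have hcardG : Nat.card (K ≃ₐ[F] K) = n := (IsGalois.card_aut_eq_finrank F K).trans hn
    haveI : Nontrivial (K ≃ₐ[F] K) := by
      rw [← Finite.one_lt_card_iff_nontrivial, hcardG]; exact h1
    obtain ⟨N, hN, hNp⟩ := exists_normal_index_prime_of_isSolvable (K ≃ₐ[F] K)
    haveI := hN
    set F₁ : IntermediateField F K := IntermediateField.fixedField N with hF₁def
    haveI : IsGalois F F₁ := IsGalois.of_fixedField_normal_subgroup N
    haveI : NumberField F₁ := NumberField.of_module_finite F F₁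
    -- degrees
    have hdeg₁ : Module.finrank F₁ K = Nat.card N := IntermediateField.finrank_fixedField_eq_card N
    have hmul : Module.finrank F F₁ * Module.finrank F₁ K = n := by
      rw [Module.finrank_mul_finrank, hn]
    have hidx : N.index * Nat.card N = n := by rw [Subgroup.index_mul_card, hcardG]
    have hdegF₁ : Module.finrank F F₁ = N.index := by
      have hpos : 0 < Nat.card N := Nat.card_pos
      apply Nat.eq_of_mul_eq_mul_right hpos
      rw [← hdeg₁, hmul, hdeg₁, hidx]
    have hlt : Module.finrank F₁ K < n := by
      have h2 := hNp.one_lt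
      rw [hdeg₁, ← hidx]
      have hpos : 0 < Nat.card N := Nat.card_pos
      nlinarith
    have hone : 1 < Module.finrank F₁ K := by
      rw [hdeg₁]
      by_contra hle
      push Not at hle
      have hc1 : Nat.card N = 1 := le_antisymm hle Nat.card_pos
      rw [hc1, mul_one] at hidx
      exact hprime (hidx ▸ hNp)
    -- solvability of `Gal(K/F₁) ≅ N`
    haveI : IsSolvable (K ≃ₐ[F₁] K) := by
      have e : (F₁.fixingSubgroup : Subgroup (K ≃ₐ[F] K)) ≃* (K ≃ₐ[F₁] K) :=
        IntermediateField.fixingSubgroupEquiv F₁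
      exact solvable_of_surjective (f := e.toMonoidHom) (by exact e.surjective)
    -- the step `F → F₁` and the induction hypothesis for `K / F₁`
    obtain ⟨π₁, hwt₁, hπ₁⟩ := exists_cuspidal_hasWeightZero_frobenius_step hBC hArch W
      (hdegF₁ ▸ hNp) (φK.comp (algebraMap F₁ K)) π hwt hπ (isCompact_glFiniteIntegralLevel_holds 2 _)
    exact ih (Module.finrank F₁ K) hlt F₁ rfl hone π₁ hwt₁ hπ₁ hK

end Tower

/-! ### Conclusion: modularity of `E₀ ⊗ K` -/

section Conclusion

open WeierstrassCurve

/-- `Δ(E₀) ∉ w` for all but finitely many places `w`, for an integral model with `Δ ≠ 0`.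
[folklore] -/
theorem eventually_Δ_not_mem {K : Type} [Field K] [NumberField K] (E : WeierstrassCurve (𝓞 K))
    (hΔ : E.Δ ≠ 0) : ∀ᶠ w : HeightOneSpectrum (𝓞 K) in cofinite, E.Δ ∉ w.asIdeal := by
  have hne : Ideal.span {E.Δ} ≠ ⊥ := by
    rw [Ne, Ideal.span_singleton_eq_bot]
    exact hΔ
  refine Filter.mem_of_superset (Ideal.finite_factors hne).compl_mem_cofinite ?_
  intro v hv hmem
  exact hv (Ideal.dvd_span_singleton.2 hmem)

open scoped Classical in
/-- **From the Satake–Frobenius compatibility to Caraiani–Newton modularity.**  If a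
weight-zero cuspidal `Π` on `GL₂(𝔸_K)` has Satake parameters `{α₁, α₂}` with
`(X - √q_w α₁)(X - √q_w α₂) = X² - a_w(E₀ ⊗ K) X + q_w` at almost every `w`, then the integral
model `E₀ ⊗ 𝓞 K` is modular (`IsModularEllipticCurve`): `√q_w (α₁ + α₂) = a_w(E₀ ⊗ K)`, and at
`w ∤ Δ(E₀)` this is the point-count trace `frobTraceAt (E₀ ⊗ 𝓞 K) w`
(`frobeniusTraceAt_baseChange_eq_frobTraceAt`). [cite: CaraianiNewton2023, p. 2 (definition of modular)] -/
theorem isModularEllipticCurve_of_eventually_hasSatakeParamAt {K : Type} [Field K] [NumberField K]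
    (E₀ : WeierstrassCurve ℤ) (hΔ : E₀.Δ ≠ 0) {hK : isCompact_glFiniteIntegralLevel 2 K}
    (P : CuspidalAutomorphicRepData 2 K hK) (hwt : P.1.HasWeightZero)
    (hP : ∀ᶠ w : HeightOneSpectrum (𝓞 K) in cofinite, ∃ β : Multiset ℂ,
      P.1.HasSatakeParamAt w β ∧
        (β.map fun z => X - C ((((Real.sqrt (w.residueCard : ℝ)) : ℝ) : ℂ) * z)).prod =
          X ^ 2 - C ((((E₀.baseChange ℚ).baseChange K).frobeniusTraceAt w : ℤ) : ℂ) * X +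
            C ((w.residueCard : ℕ) : ℂ)) :
    IsModularEllipticCurve K (E₀.baseChange (𝓞 K)) := by
  classical
  refine Or.inr ⟨hK, P, hwt, ?_⟩
  have hΔK : (E₀.baseChange (𝓞 K)).Δ ≠ 0 := by
    rw [WeierstrassCurve.baseChange, WeierstrassCurve.map_Δ]
    exact (map_ne_zero_iff _ (algebraMap ℤ (𝓞 K)).injective_int).mpr hΔ
  have hWK : (E₀.baseChange ℚ).baseChange K = (E₀.baseChange (𝓞 K)).baseChange K := by
    simp only [WeierstrassCurve.baseChange, WeierstrassCurve.map_map]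
    exact congrArg E₀.map (Subsingleton.elim _ _)
  filter_upwards [hP, eventually_Δ_not_mem _ hΔK] with w hw hΔw
  obtain ⟨β, hβ, hprod⟩ := hw
  refine ⟨β, hβ, ?_⟩
  rw [← frobeniusTraceAt_baseChange_eq_frobTraceAt hΔw, ← hWK]
  obtain ⟨x, y, rfl⟩ := Multiset.card_eq_two.mp hβ.card_eq
  set c : ℂ := (((Real.sqrt (w.residueCard : ℝ)) : ℝ) : ℂ) with hc
  simp only [Multiset.insert_eq_cons, Multiset.map_cons, Multiset.map_singleton,
    Multiset.prod_cons, Multiset.prod_singleton, Multiset.sum_cons, Multiset.sum_singleton]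
    at hprod ⊢
  have emul : (X - C (c * x)) * (X - C (c * y)) =
      X ^ 2 - C (c * x + c * y) * X + C (c * x * (c * y)) := by
    simp only [map_add, map_mul]; ring
  rw [emul] at hprod
  have e1 := congrArg (fun P : ℂ[X] ↦ P.coeff 1) hprod
  simp only [coeff_add, coeff_sub, coeff_C_mul, coeff_X_pow, coeff_X_one, coeff_C,
    if_neg (one_ne_zero), if_neg (show (1 : ℕ) ≠ 2 by decide)] at e1
  rw [mul_add]
  linear_combination -e1

/-- `E₀ ⊗ ℚ` is an elliptic curve when `Δ(E₀) ≠ 0`. [folklore] -/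
theorem isElliptic_baseChange_rat (E₀ : WeierstrassCurve ℤ) (hΔ : E₀.Δ ≠ 0) :
    (E₀.baseChange ℚ).IsElliptic := by
  rw [WeierstrassCurve.isElliptic_iff, WeierstrassCurve.baseChange, WeierstrassCurve.map_Δ,
    isUnit_iff_ne_zero]
  exact (map_ne_zero_iff _ (algebraMap ℤ ℚ).injective_int).mpr hΔ

/-- `(E₀ ⊗ ℚ) ⊗ ℚ = E₀ ⊗ ℚ`. [folklore] -/
theorem baseChange_rat_baseChange_rat (E₀ : WeierstrassCurve ℤ) :
    (E₀.baseChange ℚ).baseChange ℚ = E₀.baseChange ℚ := by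
  rw [WeierstrassCurve.baseChange, Algebra.algebraMap_self, WeierstrassCurve.map_id]

open scoped Classical in
/-- **Modularity of `E₀ ⊗ K` for `K ≠ ℚ` totally real, solvable and Galois over `ℚ`, from the
three printed inputs** — the Modularity Theorem over `ℚ` (`exists_isNewformOf`, BCDT Thm. A),
Arthur–Clozel's cyclic base change of prime degree with its cuspidality criterion
(`baseChange_cyclic_cuspidal`, Thm. III.4.2 (a)) and its archimedean component
(`ArthurClozel1989_strongLifting_archimedean`, Thm. III.5.1): Thorne 2016, Lemma 7.1 with `F = ℚ`
("`π_K = BC_{K/ℚ}(π(E₀))` exists as `K/ℚ` is solvable").  The case `[K : ℚ] > 1` of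
`isModularEllipticCurve_baseChange_rat_of_isSolvable`; the weight-zero `π(E₀)` is
`exists_hasWeightZero_satake_of_exists_isNewformOf`, the tower is
`exists_cuspidal_hasWeightZero_frobenius_of_isSolvable`, the conclusion
`isModularEllipticCurve_of_eventually_hasSatakeParamAt`.  (For `[K : ℚ] = 1`, i.e. `K ≃ ℚ`, see
`isModularEllipticCurve_rat_of_exists_isNewformOf` for `K = ℚ` itself; a field `K` merely
isomorphic to `ℚ` would need transport of cuspidal data along `ℚ ≃ K`, absent from the tree.)
[cite: Thorne2016, Lemma 7.1] [cite: BCDTJAMS2001, Thm. A]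
[cite: ArthurClozelAMS120, Ch. 3 Thm. 4.2 (a) and Thm. 5.1] -/
theorem isModularEllipticCurve_baseChange_of_one_lt_finrank
    (hA : EllipticCurves.ModularForms.exists_isNewformOf) (hBC : baseChange_cyclic_cuspidal)
    (hArch : ArthurClozel1989_strongLifting_archimedean)
    (K : Type) [Field K] [NumberField K] [IsTotallyReal K] [IsGalois ℚ K] [IsSolvable (K ≃ₐ[ℚ] K)]
    (hK : 1 < Module.finrank ℚ K) (E₀ : WeierstrassCurve ℤ) (hΔ : E₀.Δ ≠ 0) :
    IsModularEllipticCurve K (E₀.baseChange (𝓞 K)) := by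
  classical
  haveI := isElliptic_baseChange_rat E₀ hΔ
  obtain ⟨π, hwt, hπ⟩ := exists_hasWeightZero_satake_of_exists_isNewformOf hA (E₀.baseChange ℚ)
    (isCompact_glFiniteIntegralLevel_holds 2 ℚ)
  rw [← baseChange_rat_baseChange_rat E₀] at hπ
  obtain ⟨P, hPwt, hP⟩ := exists_cuspidal_hasWeightZero_frobenius_of_isSolvable hBC hArch
    (E₀.baseChange ℚ) K (Module.finrank ℚ K) ℚ rfl hK π hwt hπ
    (isCompact_glFiniteIntegralLevel_holds 2 K)
  exact isModularEllipticCurve_of_eventually_hasSatakeParamAt E₀ hΔ P hPwt hP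

open scoped Classical in
/-- **Modularity of `E₀ / ℚ` itself in the sense of Caraiani–Newton, from the Modularity
Theorem** (`exists_isNewformOf`, BCDT Thm. A): the case `K = ℚ` of
`isModularEllipticCurve_baseChange_rat_of_isSolvable` (no base change needed).
[cite: BCDTJAMS2001, Thm. A] [cite: DiamondShurman2005, Thm. 8.8.3] -/
theorem isModularEllipticCurve_rat_of_exists_isNewformOf
    (hA : EllipticCurves.ModularForms.exists_isNewformOf) (E₀ : WeierstrassCurve ℤ)
    (hΔ : E₀.Δ ≠ 0) : IsModularEllipticCurve ℚ (E₀.baseChange (𝓞 ℚ)) := by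
  classical
  haveI := isElliptic_baseChange_rat E₀ hΔ
  obtain ⟨π, hwt, hπ⟩ := exists_hasWeightZero_satake_of_exists_isNewformOf hA (E₀.baseChange ℚ)
    (isCompact_glFiniteIntegralLevel_holds 2 ℚ)
  rw [← baseChange_rat_baseChange_rat E₀] at hπ
  exact isModularEllipticCurve_of_eventually_hasSatakeParamAt E₀ hΔ π hwt hπ

/-- **`isModularEllipticCurve_baseChange_rat_of_isSolvable` for `[K : ℚ] > 1`, from the three
printed inputs** (restated with the fact's own binders). [cite: Thorne2016, Lemma 7.1] -/
theorem isModularEllipticCurve_baseChange_rat_of_isSolvable_of_one_lt_finrank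
    (hA : EllipticCurves.ModularForms.exists_isNewformOf) (hBC : baseChange_cyclic_cuspidal)
    (hArch : ArthurClozel1989_strongLifting_archimedean) :
    ∀ (K : Type) [Field K] [NumberField K] [IsTotallyReal K] [IsGalois ℚ K]
      [IsSolvable (K ≃ₐ[ℚ] K)], 1 < Module.finrank ℚ K →
      ∀ (E₀ : WeierstrassCurve ℤ), E₀.Δ ≠ 0 → IsModularEllipticCurve K (E₀.baseChange (𝓞 K)) :=
  fun K _ _ _ _ _ hK E₀ hΔ =>
    isModularEllipticCurve_baseChange_of_one_lt_finrank hA hBC hArch K hK E₀ hΔ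

end Conclusion

end Literature.NumberTheory.Automorphic
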